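import Summits.QuantumFields.BalabanUV.Beta.FP.PeriodisedFormIndexWard
import Summits.QuantumFields.BalabanUV.Beta.FP.PeriodisedBorderWardContact

/-!
# `BalabanUV.Beta.FP.PeriodisedFormGaugeLeg` — road «FP» (binder row D1), ROUTE T, the (J-a) dictionary's row `a1` at level 0, WILSON SECTOR:
# **THE FLUCTUATION-LEG (RIGHT-SLOT) PURE-GAUGE LAW OF THE PERIODISED CUBIC WILSON FAMILY, AND THE WILSON HALF OF THE DOOR's WARD ROW `a1` IN CLOSED FORM**
# (sequel of this lineage's `PeriodisedFormIndexWard` — there the INDEX-slot law `Σ_b (Dλ)_b • H₁^{b} = ½•(H₀·E_λ − E_λ·H₀)`; here the MATRIX-slot law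
# `H₁^{b}·D_ψ = −(½ψ(end b) − ¼σ_ψ(·)) ⊙ H₀(·, b)`)

HONEST DEPENDENCY (page 1, mandatory): continuum YM on T⁴ ⇐ BetaPertH ∧ nine spine estimates (0/9 proved); BetaPertH ⇐ (D1) ∧ (D4) ∧ CAP+tail;
G-an2-4 gates asym, D1 and NE2/3/4.  HONEST FRAMING (cell contract, verbatim): «discharging `BetaPertH` makes Bałaban's UV stability UNCONDITIONAL —
a real constructive-QFT result; it is NOT the continuum limit and NOT the Clay problem.»  ABSOLUTE RULE (cell charter, verbatim): «No internally-minted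
statement may enter as a cited fact. Every hypothesis is either kernel-proved in this package or a verbatim quotation of a PUBLISHED theorem with page
reference. The manuscript(s) under audit are NOT citable for their own disputed steps — they are the thing under adjudication; programme-internal
(2001/route/tribunal) claims are never citable.»

WHY.  leaf-02's level-0 door U21 (`FP/NestedStepLawTorusTransportedRowsGradedLevelZeroSymULowClosedLamW2Q2`) DISPLAYS the graded Ward row
`a1 : H₁·[D₂|D₁] + H₀·W₁ = 𝔔₀ᵀ·Y₁` with `H₁ = (−2c) • Σ_b h b • perF (dper (wilsonA d b))|_{ff} + w • Λ(h)`, `W₁(h)` the generator jet (weight `−c`,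
`c = (Lc^{d+1}·stepScale d Lc 0)⁻¹`), `D₁ ∕ D₂` the fine ∕ block-constant torus gauge modes.  The OWNER d1-p3's memo (31d) lists «(β) `a1 a2 t2` for the total
pinned tables» as a blocker of the (T-ID) level-0 assembly.  THIS FILE computes the WILSON HALF of the left side EXACTLY: the end-of-index-bond readings of
`H₁^W·[D₂|D₁]` and of `H₀·W₁` CANCEL, and what survives is DIAGONAL in the fluctuation bond `v` — `−(c∕2)·(H₀ h)_v·σ_e(v)`, the linearised-KKT residual `H₀ h` read
at the two endpoints of `v`.  Hence `a1` is a property of the DIRECTION `h` (it can hold only where `c•H₀h` is compensated by the Λ half's `Q₁₀ᵀ`-terms — the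
linearised KKT directions with the dictionary's multiplier jet), not a table identity; the assembly discharges it per direction.

CONTENT ([folklore] finite sums and period unfolding BY NAME over OUR typed objects — leaf-02's lattice law `ContactOneGaugeCellAlgebra.tsum_wilsonA_mul_dz`
(gan24 cell), leaf-02's torus pairing pattern `PeriodisedBorderWardContact.sum_perZ_mul_tgrad` ∕ `PeriodisedBorderTables.dper_apply_of_blockCov`, an2's
`bhK_inl_inl_eq`, this lineage's window letters; no `def`, no `def … : Prop`, nothing cited, 0 sorry):
§1 `sum_perZ_mul_grad_periodic_ff`; §2 **`sum_perZ_dper_wilsonA_mul_grad_periodic`** (any box, any `Mℤ^{d+1}`-periodic potential); §3 `sum_perZ_dper_wilsonA_mul_tgrad`,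
`sum_perZ_dper_wilsonA_mul_tgradBlock`; §4 **`torus_a1_wilson`** (U21's binder shapes `hH₀` (rooted form, any root ∕ window — the sym-chart form block is this at
`r := ctrOff` by leaf-02's `perF_bhKStepSh_Dsh_ff_eq_perF_bhKStepAt`), `hD₁ hD₂` (column maps generic), `hW₁` VERBATIM).
Discharges NO binder of row D1 and NO row of the door by itself; 0 estimates; 0∕4 row-D1 binders (hW, hR, D1Tel, D1Rep); NOT (J-a) complete, NOT (T-ID), NOT SDF,
NOT D1, NEVER «G-an2-4 closed», NOT BetaPertH, NOT continuum, NOT Clay.  «not in print; our bookkeeping».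
Unit `b2b-balaban-beta-d1-formalise-leaf-05` (gen 33), 2026-08-22; no existing file touched.
-/

noncomputable section

namespace Summit.QuantumFields.BalabanUV.Beta.FP.PeriodisedFormGaugeLeg

open scoped BigOperators
open Finset
open Literature.MathematicalPhysics.QuantumFieldTheory.Balaban1983to89
open Literature.MathematicalPhysics.QuantumFieldTheory.Balaban1983to89.Beta
open B4TorusKernel.MultiPeriod (translate translate_apply)
open B6Lemma24Torus (pbox mem_pbox)
open ExpKernelCalculus (MKer shiftK)
open AffineAveraging (Site box toSite unitVec dz curv curvAdj)
open AveragingContours (grad grad_eq_dz)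
open KKTFluctuationKernel (delta1)
open OneStepResolventKernel (Fib)
open StepJetData (wilsonA wilsonA_translate)
open AveragingWardStencils (b6UnitVec_eq)
open Summit.QuantumFields.BalabanUV.Beta.AxialDressingRooted (cube mem_cube)
open Summit.QuantumFields.BalabanUV.Beta.BorderedHessian (bhK bhKAt bhKAt_inl_inl bhK_inl_inl_eq bhKStepAt bhKStepAt_zero)
open Summit.QuantumFields.BalabanUV.Beta.GAN24.ContactOneGaugeCellAlgebra (tsum_wilsonA_mul_dz)
open Summit.QuantumFields.BalabanUV.Beta.GAN24.ContactOneGaugeCellMaxwell (curvAdj_curv_delta1_eq_zero_of_not_mem)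
open Summit.QuantumFields.BalabanUV.Beta.FP.KernelPeriodisationFib (Idx perF perF_apply perZ perZ_apply)
open Summit.QuantumFields.BalabanUV.Beta.FP.KernelPeriodisationFibLoc (dper)
open Summit.QuantumFields.BalabanUV.Beta.FP.KernelPeriodisationFibTrace (tsum_sites_eq_sum_tsum)
open Summit.QuantumFields.BalabanUV.Beta.FP.PeriodisedBorderTables (dper_apply_of_blockCov)
open Summit.QuantumFields.BalabanUV.Beta.FP.TorusGaugeCovariance (tdelta tdelta_translate tgrad tgrad_inl)
open Literature.MathematicalPhysics.QuantumFieldTheory.LatticeForm (quo)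
open Summit.QuantumFields.BalabanUV.Beta.FP.TorusGaugeCovarianceCoarse (tgradBlock tgradBlock_inl tdelta_quo_congr)
open B5Prop11Plancherel (fine)
open Summit.QuantumFields.BalabanUV.Beta.FP.PeriodisedFormIndexWard (wilsonA_ff_eq_zero_of_not_mem_S wilsonA_ff_eq_zero_of_not_mem_T)

variable {d : ℕ} (M : Fin (d + 1) → ℕ) [∀ μ, NeZero (M μ)]

/-! ## §1 Torus pairing = lattice pairing, ff block, ANY `Mℤ^{d+1}`-periodic potential -/

/-- [folklore] ff twin of leaf-02's `sum_perZ_mul_tgrad` for ANY periodic potential `φ`: for a kernel `K` whose `(inl α, inl β)` entries are summable against anything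
in the second slot, `Σ_{y ∈ pbox M} Σ_β perZ M K x y (inl α) (inl β) · (φ (y + e_β) − φ y) = Σ'_z Σ_β K x z (inl α) (inl β) · dz φ β z`. -/
theorem sum_perZ_mul_grad_periodic_ff (K : MKer (d + 1) (Fib d)) (x : Site (d + 1)) (α : Fin (d + 1))
    {φ : Site (d + 1) → ℝ} (hφ : ∀ z m, φ (translate M z m) = φ z)
    (hK : ∀ (β : Fin (d + 1)) (g : Site (d + 1) → ℝ), Summable fun z => K x z (Sum.inl α) (Sum.inl β) * g z) :
    ∑ y : ↥(pbox M), ∑ β : Fin (d + 1), perZ M K x (y : Site (d + 1)) (Sum.inl α) (Sum.inl β) * (φ ((y : Site (d + 1)) + unitVec β) - φ y)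
      = ∑' z : Site (d + 1), ∑ β : Fin (d + 1), K x z (Sum.inl α) (Sum.inl β) * dz φ β z := by
  set H : Fin (d + 1) → Site (d + 1) → ℝ := fun β z => K x z (Sum.inl α) (Sum.inl β) * dz φ β z with hH
  have hHs : ∀ β, Summable (H β) := fun β => hK β _
  have hgrad : ∀ (β : Fin (d + 1)) (y m : Site (d + 1)), dz φ β (translate M y m) = dz φ β y := fun β y m => by
    simp only [dz]
    rw [show translate M y m + unitVec β = translate M (y + unitVec β) m by funext i; simp only [translate_apply, Pi.add_apply]; ring, hφ, hφ]
  have hterm : ∀ (y : ↥(pbox M)) (β : Fin (d + 1)),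
      perZ M K x (y : Site (d + 1)) (Sum.inl α) (Sum.inl β) * (φ ((y : Site (d + 1)) + unitVec β) - φ y)
        = ∑' m : Site (d + 1), H β (translate M (y : Site (d + 1)) m) := fun y β => by
    rw [perZ_apply, ← tsum_mul_right]
    refine tsum_congr fun m => ?_
    simp only [hH, hgrad]
    rfl
  calc ∑ y : ↥(pbox M), ∑ β : Fin (d + 1), perZ M K x (y : Site (d + 1)) (Sum.inl α) (Sum.inl β) * (φ ((y : Site (d + 1)) + unitVec β) - φ y)
      = ∑ y : ↥(pbox M), ∑ β : Fin (d + 1), ∑' m : Site (d + 1), H β (translate M (y : Site (d + 1)) m) :=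
        Finset.sum_congr rfl fun y _ => Finset.sum_congr rfl fun β _ => hterm y β
    _ = ∑ β : Fin (d + 1), ∑ y : ↥(pbox M), ∑' m : Site (d + 1), H β (translate M (y : Site (d + 1)) m) := Finset.sum_comm
    _ = ∑ β : Fin (d + 1), ∑' z : Site (d + 1), H β z := Finset.sum_congr rfl fun β _ => (tsum_sites_eq_sum_tsum M (hHs β)).symm
    _ = ∑' z : Site (d + 1), ∑ β : Fin (d + 1), H β z := (Summable.tsum_finsetSum fun β _ => hHs β).symm

/-! ## §2 The periodised cubic Wilson family against the gradient of a periodic potential (fluctuation slot) -/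

/-- **[folklore] THE RIGHT-SLOT PURE-GAUGE LAW OF THE PERIODISED WILSON FAMILY** (any box `M`, ANY `Mℤ^{d+1}`-periodic potential `φ`; any root `ρ` and window
`L` for the form block — its ff block carries neither): for the index bond `(κ′, u)` and the left leg `(x, α)`,
`Σ_{(y,β)} perZ M (dper M (wilsonA d κ′ u)) x y (inl α) (inl β) · (φ(y + e_β) − φ y)
  = −(½ · (φ (u + e_κ′) − (φ x + φ (x + e_α))∕2) · perZ M (bhKStepAt d ρ L 0) x u (inl α) (inl κ′))`
— the potential is read at the END of the index bond (weight `½`) and at the two ENDPOINTS of the left leg (weight `−¼` each), against the form block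
`H₀(x α; u κ′)` (leaf-02's lattice law `tsum_wilsonA_mul_dz` per period copy of the index bond; the contact kernel `d*d δ_b` periodises to `H₀`). -/
theorem sum_perZ_dper_wilsonA_mul_grad_periodic (ρ : Site (d + 1)) (L : ℕ) [NeZero L]
    (κ' : Fin (d + 1)) (u x : Site (d + 1)) (α : Fin (d + 1)) {φ : Site (d + 1) → ℝ} (hφ : ∀ z m, φ (translate M z m) = φ z) :
    ∑ y : ↥(pbox M), ∑ β : Fin (d + 1), perZ M (dper M (wilsonA d κ' u)) x (y : Site (d + 1)) (Sum.inl α) (Sum.inl β) * (φ ((y : Site (d + 1)) + unitVec β) - φ y)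
      = -((1 / 2 : ℝ) * (φ (u + unitVec κ') - (φ x + φ (x + unitVec α)) / 2)
          * perZ M (bhKStepAt d ρ L 0) x u (Sum.inl α) (Sum.inl κ')) := by
  classical
  have hM1 : ∀ i, M i = 1 * M i := fun i => (one_mul (M i)).symm
  have hVt : ∀ (κ : Fin (d + 1)) (v t : Site (d + 1)), wilsonA d κ (v + ((1 : ℕ) : ℤ) • t) = shiftK (-(((1 : ℕ) : ℤ) • t)) (wilsonA d κ v) :=
    fun κ v t => wilsonA_translate κ v _
  -- the copies of the index bond that see the left leg `x` are finitely many
  have hinj : Function.Injective fun m : Site (d + 1) => translate M u m := by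
    intro m m' h
    funext i
    have hi := congrFun h i
    simp only [translate_apply] at hi
    have hMi : (M i : ℤ) ≠ 0 := by exact_mod_cast NeZero.ne (M i)
    exact mul_left_cancel₀ hMi (by linarith)
  set T : Finset (Site (d + 1)) := (cube (d + 1) 2).image (fun v => x - v) with hT
  set F : Finset (Site (d + 1)) := T.preimage (fun m => translate M u m) hinj.injOn with hF
  have hF' : ∀ m ∉ F, translate M u m ∉ T := fun m hm ht => hm (Finset.mem_preimage.2 ht)
  have hdper : ∀ (z : Site (d + 1)) (β : Fin (d + 1)),
      dper M (wilsonA d κ' u) x z (Sum.inl α) (Sum.inl β) = ∑ m ∈ F, wilsonA d κ' (translate M u m) x z (Sum.inl α) (Sum.inl β) := fun z β => by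
    rw [dper_apply_of_blockCov hM1 hVt κ' u x z]
    exact tsum_eq_sum fun m hm => wilsonA_ff_eq_zero_of_not_mem_T κ' x z α β _ (hF' m hm)
  have hK : ∀ (β : Fin (d + 1)) (g : Site (d + 1) → ℝ), Summable fun z => dper M (wilsonA d κ' u) x z (Sum.inl α) (Sum.inl β) * g z := by
    intro β g
    refine summable_of_ne_finset_zero (s := (cube (d + 1) 4).image (fun v => x - v)) fun z hz => ?_
    rw [hdper, Finset.sum_eq_zero fun m _ => wilsonA_ff_eq_zero_of_not_mem_S κ' _ x α β z hz, zero_mul]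
  rw [sum_perZ_mul_grad_periodic_ff M (dper M (wilsonA d κ' u)) x α hφ hK]
  have hswap : ∑' z : Site (d + 1), ∑ β : Fin (d + 1), dper M (wilsonA d κ' u) x z (Sum.inl α) (Sum.inl β) * dz φ β z
      = ∑ m ∈ F, ∑' z : Site (d + 1), ∑ β : Fin (d + 1), wilsonA d κ' (translate M u m) x z (Sum.inl α) (Sum.inl β) * dz φ β z := by
    have hsm : ∀ m ∈ F, Summable fun z => ∑ β : Fin (d + 1), wilsonA d κ' (translate M u m) x z (Sum.inl α) (Sum.inl β) * dz φ β z :=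
      fun m _ => summable_of_ne_finset_zero (s := (cube (d + 1) 4).image (fun v => x - v)) fun z hz =>
        Finset.sum_eq_zero fun β _ => by rw [wilsonA_ff_eq_zero_of_not_mem_S κ' _ x α β z hz, zero_mul]
    rw [← Summable.tsum_finsetSum hsm]
    refine tsum_congr fun z => ?_
    rw [Finset.sum_comm]
    refine Finset.sum_congr rfl fun β _ => ?_
    rw [hdper z β, Finset.sum_mul]
  rw [hswap]
  have hcopy : ∀ m ∈ F, ∑' z : Site (d + 1), ∑ β : Fin (d + 1), wilsonA d κ' (translate M u m) x z (Sum.inl α) (Sum.inl β) * dz φ β z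
      = -((1 / 2 : ℝ) * (φ (u + unitVec κ') - (φ x + φ (x + unitVec α)) / 2)
          * curvAdj (curv (delta1 κ' (translate M u m))) α x) := fun m _ => by
    rw [tsum_wilsonA_mul_dz κ' (translate M u m) x α φ, b6UnitVec_eq, b6UnitVec_eq,
      show translate M u m + unitVec κ' = translate M (u + unitVec κ') m by funext i; simp only [translate_apply, Pi.add_apply]; ring, hφ]
  rw [Finset.sum_congr rfl hcopy, Finset.sum_neg_distrib, ← Finset.mul_sum]
  congr 2
  -- the contact kernel, summed over the copies, IS the periodised form block entry
  have h0 : ∀ m ∉ F, bhKStepAt d ρ L 0 x (translate M u m) (Sum.inl α) (Sum.inl κ') = 0 := fun m hm => by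
    rw [bhKStepAt_zero, bhKAt_inl_inl, bhK_inl_inl_eq]
    exact curvAdj_curv_delta1_eq_zero_of_not_mem fun h => hF' m hm (Finset.mem_image.2 ⟨x - translate M u m, h, sub_sub_cancel _ _⟩)
  rw [perZ_apply, tsum_eq_sum h0]
  exact Finset.sum_congr rfl fun m _ => by rw [bhKStepAt_zero, bhKAt_inl_inl, bhK_inl_inl_eq]

/-! ## §3 The two gauge-mode families of the torus call: fine modes `tgrad` (potential `tdelta M · s`) and block-constant modes `tgradBlock` on `fine Lc M′`
(potential `tdelta M′ (quo Lc ·) t`) -/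

/-- [folklore] **`sum_perZ_dper_wilsonA_mul_tgrad`** — against a FINE gauge-mode column `s` of `tgrad M`. -/
theorem sum_perZ_dper_wilsonA_mul_tgrad (ρ : Site (d + 1)) (L : ℕ) [NeZero L]
    (κ' : Fin (d + 1)) (u x : Site (d + 1)) (α : Fin (d + 1)) (s : ↥(pbox M)) :
    ∑ y : ↥(pbox M), ∑ β : Fin (d + 1), perZ M (dper M (wilsonA d κ' u)) x (y : Site (d + 1)) (Sum.inl α) (Sum.inl β) * tgrad M (y, Sum.inl β) s
      = -((1 / 2 : ℝ) * (tdelta M (u + unitVec κ') s - (tdelta M x s + tdelta M (x + unitVec α) s) / 2)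
          * perZ M (bhKStepAt d ρ L 0) x u (Sum.inl α) (Sum.inl κ')) := by
  have h := sum_perZ_dper_wilsonA_mul_grad_periodic M ρ L κ' u x α (φ := fun z => tdelta M z s) (fun z m => tdelta_translate M z m s)
  simpa only [tgrad_inl] using h

/-- [folklore] **`sum_perZ_dper_wilsonA_mul_tgradBlock`** — against a BLOCK-CONSTANT gauge-mode column `t` of `tgradBlock M′ Lc` on the fine box `fine Lc M′`. -/
theorem sum_perZ_dper_wilsonA_mul_tgradBlock (M' : Fin (d + 1) → ℕ) [∀ μ, NeZero (M' μ)] (Lc : ℕ) [NeZero Lc] (ρ : Site (d + 1)) (L : ℕ) [NeZero L]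
    (κ' : Fin (d + 1)) (u x : Site (d + 1)) (α : Fin (d + 1)) (t : ↥(pbox M')) :
    ∑ y : ↥(pbox (fine Lc M')), ∑ β : Fin (d + 1),
        perZ (fine Lc M') (dper (fine Lc M') (wilsonA d κ' u)) x (y : Site (d + 1)) (Sum.inl α) (Sum.inl β) * tgradBlock M' Lc (y, Sum.inl β) t
      = -((1 / 2 : ℝ) * (tdelta M' (quo Lc (u + unitVec κ')) t - (tdelta M' (quo Lc x) t + tdelta M' (quo Lc (x + unitVec α)) t) / 2)
          * perZ (fine Lc M') (bhKStepAt d ρ L 0) x u (Sum.inl α) (Sum.inl κ')) := by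
  have hφ : ∀ z m : Site (d + 1), tdelta M' (quo Lc (translate (fine Lc M') z m)) t = tdelta M' (quo Lc z) t := fun z m => by
    refine tdelta_quo_congr M' Lc (fun i => ⟨m i, ?_⟩) t
    simp only [translate_apply, fine]
    push_cast
    ring
  have h := sum_perZ_dper_wilsonA_mul_grad_periodic (fine Lc M') ρ L κ' u x α (φ := fun z => tdelta M' (quo Lc z) t) hφ
  simpa only [tgradBlock_inl] using h

/-! ## §4 THE WILSON HALF OF THE LEVEL-0 DOOR's WARD ROW `a1` (U21's binders `hH₀` (rooted form, any root∕window), `hD₁ hD₂ hW₁` with the column selections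
generic, the Wilson weight `−2c` and the generator-jet weight `−c` as in U21 with `c := (Lc^{d+1}·stepScale d Lc 0)⁻¹` generic): the END-OF-BOND readings CANCEL
between `H₁^W·[D₂|D₁]` and `H₀·W₁`, and what is left is DIAGONAL in the fluctuation bond: `−(c∕2) · (H₀ h)_v · (ψ_e(v.1) + ψ_e(v.1 + e_{v.2}))`. -/

/-- **[folklore] `torus_a1_wilson` — THE WILSON SECTOR OF THE DOOR's `a1` ROW IN CLOSED FORM**: on the fine box `F = fine Lc M′`, for any bond weight `h`, any `c`,
`((−2c) • Σ_b h b • W_b) * fromCols D₂ D₁ + H₀ * W₁(h) = −(c∕2) • of (v e ↦ (H₀ *ᵥ h) v · σ_e(v))`, `σ_e(v) :=` the column's potential at the two endpoints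
of the fluctuation bond `v` (`tdelta M′ (quo Lc ·) (g₂ t)` for block-constant columns, `tdelta F · (g₁ s)` for fine columns).  So the Wilson half of `a1` is
`𝔔₀ᵀ·Y₁`-shaped for NO `Y₁` in general: it is the diagonal reading of the linearised-KKT residual `H₀ h` (zero exactly on `H₀`-harmonic directions). -/
theorem torus_a1_wilson (M' : Fin (d + 1) → ℕ) [∀ μ, NeZero (M' μ)] (Lc : ℕ) [NeZero Lc] (ρ : Site (d + 1)) (L : ℕ) [NeZero L]
    {γ₁ γ₂ : Type*} [Fintype γ₁] [Fintype γ₂] (g₁ : γ₁ → ↥(pbox (fine Lc M'))) (g₂ : γ₂ → ↥(pbox M')) (c : ℝ)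
    (h : ↥(pbox (fine Lc M')) × Fin (d + 1) → ℝ)
    {H₀ : Matrix (↥(pbox (fine Lc M')) × Fin (d + 1)) (↥(pbox (fine Lc M')) × Fin (d + 1)) ℝ}
    (hH₀ : H₀ = (perF (fine Lc M') (bhKStepAt d ρ L 0)).submatrix
        (fun b : ↥(pbox (fine Lc M')) × Fin (d + 1) => ((b.1, Sum.inl b.2) : Idx (fine Lc M') (Fib d)))
        (fun b : ↥(pbox (fine Lc M')) × Fin (d + 1) => ((b.1, Sum.inl b.2) : Idx (fine Lc M') (Fib d))))
    {D₁ : Matrix (↥(pbox (fine Lc M')) × Fin (d + 1)) γ₁ ℝ}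
    (hD₁ : D₁ = (tgrad (fine Lc M')).submatrix (fun b : ↥(pbox (fine Lc M')) × Fin (d + 1) => ((b.1, Sum.inl b.2) : Idx (fine Lc M') (Fib d))) g₁)
    {D₂ : Matrix (↥(pbox (fine Lc M')) × Fin (d + 1)) γ₂ ℝ}
    (hD₂ : D₂ = (tgradBlock M' Lc).submatrix (fun b : ↥(pbox (fine Lc M')) × Fin (d + 1) => ((b.1, Sum.inl b.2) : Idx (fine Lc M') (Fib d))) g₂)
    {W₁ : Matrix (↥(pbox (fine Lc M')) × Fin (d + 1)) (γ₂ ⊕ γ₁) ℝ}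
    (hW₁ : W₁ = ∑ b : ↥(pbox (fine Lc M')) × Fin (d + 1), h b •
        Matrix.of (fun (b' : ↥(pbox (fine Lc M')) × Fin (d + 1)) (e : γ₂ ⊕ γ₁) =>
          if b' = b then
            -c * Sum.elim (fun t : γ₂ => tdelta M' (quo Lc ((b.1 : Site (d + 1)) + unitVec b.2)) (g₂ t))
                  (fun s : γ₁ => tdelta (fine Lc M') ((b.1 : Site (d + 1)) + unitVec b.2) (g₁ s)) e
          else 0)) :
    ((-2 * c) • ∑ b : ↥(pbox (fine Lc M')) × Fin (d + 1), h b •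
          (perF (fine Lc M') (dper (fine Lc M') (wilsonA d b.2 (b.1 : Site (d + 1))))).submatrix
            (fun b : ↥(pbox (fine Lc M')) × Fin (d + 1) => ((b.1, Sum.inl b.2) : Idx (fine Lc M') (Fib d)))
            (fun b : ↥(pbox (fine Lc M')) × Fin (d + 1) => ((b.1, Sum.inl b.2) : Idx (fine Lc M') (Fib d))))
        * Matrix.fromCols D₂ D₁ + H₀ * W₁
      = -(c / 2) • Matrix.of (fun (v : ↥(pbox (fine Lc M')) × Fin (d + 1)) (e : γ₂ ⊕ γ₁) =>
          H₀.mulVec h v * Sum.elim (fun t : γ₂ => tdelta M' (quo Lc (v.1 : Site (d + 1))) (g₂ t) + tdelta M' (quo Lc ((v.1 : Site (d + 1)) + unitVec v.2)) (g₂ t))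
            (fun s : γ₁ => tdelta (fine Lc M') (v.1 : Site (d + 1)) (g₁ s) + tdelta (fine Lc M') ((v.1 : Site (d + 1)) + unitVec v.2) (g₁ s)) e) := by
  -- entries of the three ingredients
  have hH0 : ∀ v b : ↥(pbox (fine Lc M')) × Fin (d + 1),
      H₀ v b = perZ (fine Lc M') (bhKStepAt d ρ L 0) (v.1 : Site (d + 1)) (b.1 : Site (d + 1)) (Sum.inl v.2) (Sum.inl b.2) := fun v b => by
    rw [hH₀]; rfl
  have hW1 : ∀ (b' : ↥(pbox (fine Lc M')) × Fin (d + 1)) (e : γ₂ ⊕ γ₁),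
      W₁ b' e = h b' * (-c * Sum.elim (fun t : γ₂ => tdelta M' (quo Lc ((b'.1 : Site (d + 1)) + unitVec b'.2)) (g₂ t))
        (fun s : γ₁ => tdelta (fine Lc M') ((b'.1 : Site (d + 1)) + unitVec b'.2) (g₁ s)) e) := fun b' e => by
    rw [hW₁, Matrix.sum_apply]
    simp only [Matrix.smul_apply, Matrix.of_apply, smul_eq_mul, mul_ite, mul_zero]
    rw [Finset.sum_ite_eq]
    simp only [Finset.mem_univ, if_true]
  have hWD₂ : ∀ (b v : ↥(pbox (fine Lc M')) × Fin (d + 1)) (t : γ₂),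
      ((perF (fine Lc M') (dper (fine Lc M') (wilsonA d b.2 (b.1 : Site (d + 1))))).submatrix
            (fun b : ↥(pbox (fine Lc M')) × Fin (d + 1) => ((b.1, Sum.inl b.2) : Idx (fine Lc M') (Fib d)))
            (fun b : ↥(pbox (fine Lc M')) × Fin (d + 1) => ((b.1, Sum.inl b.2) : Idx (fine Lc M') (Fib d))) * D₂) v t
        = -((1 / 2 : ℝ) * (tdelta M' (quo Lc ((b.1 : Site (d + 1)) + unitVec b.2)) (g₂ t)
              - (tdelta M' (quo Lc (v.1 : Site (d + 1))) (g₂ t) + tdelta M' (quo Lc ((v.1 : Site (d + 1)) + unitVec v.2)) (g₂ t)) / 2)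
            * perZ (fine Lc M') (bhKStepAt d ρ L 0) (v.1 : Site (d + 1)) (b.1 : Site (d + 1)) (Sum.inl v.2) (Sum.inl b.2)) := fun b v t => by
    rw [hD₂, Matrix.mul_apply, Fintype.sum_prod_type]
    simp only [Matrix.submatrix_apply, perF_apply]
    exact sum_perZ_dper_wilsonA_mul_tgradBlock M' Lc ρ L b.2 (b.1 : Site (d + 1)) (v.1 : Site (d + 1)) v.2 (g₂ t)
  have hWD₁ : ∀ (b v : ↥(pbox (fine Lc M')) × Fin (d + 1)) (s : γ₁),
      ((perF (fine Lc M') (dper (fine Lc M') (wilsonA d b.2 (b.1 : Site (d + 1))))).submatrix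
            (fun b : ↥(pbox (fine Lc M')) × Fin (d + 1) => ((b.1, Sum.inl b.2) : Idx (fine Lc M') (Fib d)))
            (fun b : ↥(pbox (fine Lc M')) × Fin (d + 1) => ((b.1, Sum.inl b.2) : Idx (fine Lc M') (Fib d))) * D₁) v s
        = -((1 / 2 : ℝ) * (tdelta (fine Lc M') ((b.1 : Site (d + 1)) + unitVec b.2) (g₁ s)
              - (tdelta (fine Lc M') (v.1 : Site (d + 1)) (g₁ s) + tdelta (fine Lc M') ((v.1 : Site (d + 1)) + unitVec v.2) (g₁ s)) / 2)
            * perZ (fine Lc M') (bhKStepAt d ρ L 0) (v.1 : Site (d + 1)) (b.1 : Site (d + 1)) (Sum.inl v.2) (Sum.inl b.2)) := fun b v s => by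
    rw [hD₁, Matrix.mul_apply, Fintype.sum_prod_type]
    simp only [Matrix.submatrix_apply, perF_apply]
    exact sum_perZ_dper_wilsonA_mul_tgrad (fine Lc M') ρ L b.2 (b.1 : Site (d + 1)) (v.1 : Site (d + 1)) v.2 (g₁ s)
  rw [Matrix.mul_fromCols]
  ext v e
  rw [Matrix.add_apply, Matrix.smul_apply, Matrix.of_apply, Matrix.mul_apply]
  simp only [hW1, Matrix.mulVec, dotProduct, hH0]
  cases e with
  | inl t =>
      rw [Matrix.fromCols_apply_inl, Matrix.smul_mul, Matrix.sum_mul, Matrix.smul_apply, Matrix.sum_apply]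
      simp only [Matrix.smul_mul, Matrix.smul_apply, hWD₂, smul_eq_mul, Sum.elim_inl]
      rw [Finset.mul_sum, Finset.sum_mul, Finset.mul_sum, ← Finset.sum_add_distrib]
      refine Finset.sum_congr rfl fun b _ => ?_
      ring
  | inr s =>
      rw [Matrix.fromCols_apply_inr, Matrix.smul_mul, Matrix.sum_mul, Matrix.smul_apply, Matrix.sum_apply]
      simp only [Matrix.smul_mul, Matrix.smul_apply, hWD₁, smul_eq_mul, Sum.elim_inr]
      rw [Finset.mul_sum, Finset.sum_mul, Finset.mul_sum, ← Finset.sum_add_distrib]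
      refine Finset.sum_congr rfl fun b _ => ?_
      ring

end Summit.QuantumFields.BalabanUV.Beta.FP.PeriodisedFormGaugeLeg

end
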